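import Mathlib
import Summits.KontsevichZagierPeriods.KontsevichZagierPeriods.Theorems.SoloInformedChartCore
import HarnessLib

/-!
# SoloInformed — chords in the core of a chart (toolkit for the Stokes grid of (HT))

File I4a of the (HT) step (`SoloInformedNashHT`) of the solo-informed programme.

* Around a point of the core of a chart `c` (`soloInformedCore c`), a whole ball of curve points
  lies in the core; at every curve point there is a chart with that point in its core and with
  domain `Ω` inside any prescribed open set (`exists_localChart_subset`).
* The **chord** `soloInformedChord c p q` of a chart `c` from `p` to `q` (both in the core): the
  image under `ψ` of the segment between the chart coordinates, run through at the smoothed pace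
  of `soloInformedChartPiece` (`N = 1`, `r = 0`).  It runs in the core for all times (the core
  disc is convex), starts at `p`, ends at `q`, and is a Nash map when `p, q` have algebraic
  coordinates (`soloInformed_reImSA_chartPiece`).

References: Huber–Wüstholz, *Transcendence and linear relations of 1-periods* (2022), §3.3.1;
Bochnak–Coste–Roy, *Real algebraic geometry* (1998), Prop. 8.1.8.
-/

noncomputable section

open scoped Topology
open Set Metric
open Literature.NumberTheory.Transcendental Literature.NumberTheory.Transcendental.KZ
open Literature.NumberTheory.Transcendental.CurvePeriods
open Literature.ModelTheory.ExponentialFields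

namespace Summit.KontsevichZagierPeriods.KontsevichZagierPeriods.Theorems

variable {Z : CurveData}

/-! ## 1. Balls in cores, charts with prescribed core point -/

/-- Around a core point, a whole ball of curve points lies in the core. -/
theorem soloInformed_exists_ball_subset_core (c : SoloInformedChart Z) {g : Fin Z.n → ℂ}
    (hg : g ∈ soloInformedCore c) :
    ∃ ρ > 0, ball g ρ ∩ Z.points ⊆ soloInformedCore c := by
  have hO : IsOpen (c.Ω ∩ {z : Fin Z.n → ℂ | z c.i₀ ∈ ball c.w₀ (c.ε / 4)}) :=
    c.isOpen.inter (isOpen_ball.preimage (continuous_apply c.i₀))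
  obtain ⟨ρ, hρ, hball⟩ := Metric.isOpen_iff.1 hO g ⟨hg.2.1, hg.2.2⟩
  exact ⟨ρ, hρ, fun z hz => ⟨hz.2, (hball hz.1).1, (hball hz.1).2⟩⟩

/-- **A chart with a given core point and domain inside a given open set.** [folklore] -/
theorem soloInformed_exists_chart_core_subset (hZ : Z.IsSmoothAffineCurve) {g : Fin Z.n → ℂ}
    (hg : g ∈ Z.points) {G : Set (Fin Z.n → ℂ)} (hG : IsOpen G) (hgG : g ∈ G) :
    ∃ c : SoloInformedChart Z, g ∈ soloInformedCore c ∧ c.Ω ⊆ G := by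
  obtain ⟨i₀, ε, Ω, ψ, hε, hΩ, hgΩ, hΩG, hψ, h1, h2⟩ := exists_localChart_subset hZ hg hG hgG
  exact ⟨⟨i₀, g i₀, ε, Ω, ψ, hΩ, hψ, h1, h2⟩, ⟨hg, hgΩ, mem_ball_self (by positivity)⟩, hΩG⟩

/-- The core lies in the chart domain. -/
theorem soloInformed_core_subset_Ω (c : SoloInformedChart Z) : soloInformedCore c ⊆ c.Ω :=
  fun _ hz => hz.2.1

/-- The core lies on the curve. -/
theorem soloInformed_core_subset_points (c : SoloInformedChart Z) :
    soloInformedCore c ⊆ Z.points := fun _ hz => hz.1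

/-! ## 2. Chords -/

/-- **The chord** of the chart `c` from `p` to `q`. -/
def soloInformedChord (c : SoloInformedChart Z) (p q : Fin Z.n → ℂ) (t : ℝ) : Fin Z.n → ℂ :=
  soloInformedChartPiece c.ψ (p c.i₀) (q c.i₀) 1 0 t

section Chord

variable (c : SoloInformedChart Z) {p q : Fin Z.n → ℂ}

/-- The chord parameter stays in the core disc. -/
theorem soloInformed_chord_coord_mem (hp : p ∈ soloInformedCore c) (hq : q ∈ soloInformedCore c)
    (t : ℝ) : segPoint (p c.i₀) (q c.i₀) (soloInformedStep 1 0 t) ∈ ball c.w₀ (c.ε / 4) :=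
  soloInformed_segPoint_step_mem one_pos hp.2.2 hq.2.2 t

/-- **The chord runs in the core of its chart** (for all times). -/
theorem soloInformed_chord_mem_core (hp : p ∈ soloInformedCore c) (hq : q ∈ soloInformedCore c)
    (t : ℝ) : soloInformedChord c p q t ∈ soloInformedCore c := by
  have hw := soloInformed_chord_coord_mem c hp hq t
  have hw' : segPoint (p c.i₀) (q c.i₀) (soloInformedStep 1 0 t) ∈ ball c.w₀ c.ε :=
    Metric.ball_subset_ball (by linarith [c.eps_pos_of_mem_core hp]) hw
  obtain ⟨hΩ, hZ, hi⟩ := c.right_inv _ hw'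
  refine ⟨hZ, hΩ, ?_⟩
  show c.ψ (segPoint (p c.i₀) (q c.i₀) (soloInformedStep 1 0 t)) c.i₀ ∈ ball c.w₀ (c.ε / 4)
  rw [hi]
  exact hw

/-- The chord runs on the curve. -/
theorem soloInformed_chord_mem_points (hp : p ∈ soloInformedCore c)
    (hq : q ∈ soloInformedCore c) (t : ℝ) : soloInformedChord c p q t ∈ Z.points :=
  (soloInformed_chord_mem_core c hp hq t).1

/-- The chord starts at `p`. -/
theorem soloInformed_chord_zero (hp : p ∈ soloInformedCore c) (q : Fin Z.n → ℂ) :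
    soloInformedChord c p q 0 = p := by
  rw [soloInformedChord, soloInformedChartPiece_of_le (N := 1) (r := 0) one_pos (by norm_num)]
  exact c.psi_coord_of_mem_core hp

/-- The chord ends at `q`. -/
theorem soloInformed_chord_one (p : Fin Z.n → ℂ) (hq : q ∈ soloInformedCore c) :
    soloInformedChord c p q 1 = q := by
  rw [soloInformedChord, soloInformedChartPiece_of_ge (N := 1) (r := 0) one_pos (by norm_num)]
  exact c.psi_coord_of_mem_core hq

/-- **The chord between points with algebraic coordinates is a Nash map.**
[BCR 1998, Prop. 8.1.8; Huber–Wüstholz 2022, §3.3.1] -/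
theorem soloInformed_isNashPath_chord (hZ : Z.IsSmoothAffineCurve) (hp : p ∈ soloInformedCore c)
    (hq : q ∈ soloInformedCore c) (hpa : ∀ i, IsAlgebraic ℚ (p i))
    (hqa : ∀ i, IsAlgebraic ℚ (q i)) : SoloInformedIsNashPath (soloInformedChord c p q) := by
  have hp' : p c.i₀ ∈ ball c.w₀ c.ε := c.coord_mem_ball_of_mem_core hp
  have hq' : q c.i₀ ∈ ball c.w₀ c.ε := c.coord_mem_ball_of_mem_core hq
  refine ⟨1, one_pos, ?_, fun j => ?_⟩
  · refine (soloInformed_contDiffOn_chartPiece (N := 1) (r := 0) one_pos c.analytic hp'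
      hq').mono fun t ht => ⟨?_, ?_⟩
    · push_cast at ht; linarith [ht.1]
    · push_cast at ht; linarith [ht.2]
  · have hset :
        soloInformedIoo1 (-((1 : ℚ) : ℝ)) (1 + ((1 : ℚ) : ℝ)) = soloInformedIoo1 (-1) 2 := by
      norm_num
    rw [hset]
    exact soloInformed_reImSA_chartPiece (N := 1) (r := 0) one_pos hZ.algebraic c.isOpen
      c.continuousOn c.left_inv c.right_inv hp' hq' (hpa _) (hqa _) j

end Chord

end Summit.KontsevichZagierPeriods.KontsevichZagierPeriods.Theorems

/-!
# SoloInformed — uniform chart radii along a compact set of curve points (Lebesgue numbers)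

File I4b of the (HT) step (`SoloInformedNashHT`) of the solo-informed programme.

For a compact set `K ⊆ Z(ℂ)` (the image of a homotopy):
* **coarse radius** (`soloInformed_exists_coreRadius`): one `ρ > 0` such that for every `k ∈ K`
  the curve points of `ball k ρ` lie in the core of a single chart;
* **fine radius** (`soloInformed_exists_fineRadius`): given `r > 0`, one `σ > 0` such that for every
  `k ∈ K` the curve points of `ball k σ` lie in the core of a chart whose core lies in `ball k r`.
Both are the Lebesgue number lemma applied to covers by balls sitting in cores
(`soloInformed_exists_ball_subset_core`, `soloInformed_exists_chart_core_subset`).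

References: Huber–Wüstholz, *Transcendence and linear relations of 1-periods* (2022), §7.2
(the subdivision of a homotopy into small cells); Munkres, *Topology*, Lemma 27.5.
-/


open scoped Topology
open Set Metric
open Literature.NumberTheory.Transcendental Literature.NumberTheory.Transcendental.KZ
open Literature.NumberTheory.Transcendental.CurvePeriods
open Literature.ModelTheory.ExponentialFields

namespace Summit.KontsevichZagierPeriods.KontsevichZagierPeriods.Theorems

variable {Z : CurveData} {K : Set (Fin Z.n → ℂ)}

/-- **Coarse radius.**  Along a compact set of curve points there is one radius `ρ > 0` such that
the curve points `ρ`-close to any point of the set lie in the core of one chart. -/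
theorem soloInformed_exists_coreRadius (hZ : Z.IsSmoothAffineCurve) (hK : IsCompact K)
    (hKZ : K ⊆ Z.points) :
    ∃ ρ > 0, ∀ k ∈ K, ∃ c : SoloInformedChart Z, ball k ρ ∩ Z.points ⊆ soloInformedCore c := by
  let ι := {q : (Fin Z.n → ℂ) × ℝ × SoloInformedChart Z //
    ball q.1 q.2.1 ∩ Z.points ⊆ soloInformedCore q.2.2}
  have hcov : K ⊆ ⋃ i : ι, ball i.1.1 i.1.2.1 := by
    intro k hk
    obtain ⟨c, hkc, -⟩ :=
      soloInformed_exists_chart_core_subset hZ (hKZ hk) isOpen_univ (mem_univ k)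
    obtain ⟨ρ, hρ, hsub⟩ := soloInformed_exists_ball_subset_core c hkc
    exact mem_iUnion.2 ⟨⟨(k, ρ, c), hsub⟩, mem_ball_self hρ⟩
  obtain ⟨δ, hδ, hleb⟩ := lebesgue_number_lemma_of_metric hK (fun _ : ι => isOpen_ball) hcov
  refine ⟨δ, hδ, fun k hk => ?_⟩
  obtain ⟨i, hi⟩ := hleb k hk
  exact ⟨i.1.2.2, fun z hz => i.2 ⟨hi hz.1, hz.2⟩⟩

/-- **Fine radius.**  Given `r > 0`, along a compact set of curve points there is one radius
`σ > 0` such that the curve points `σ`-close to any point `k` of the set lie in the core of a chart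
whose core lies in `ball k r`. -/
theorem soloInformed_exists_fineRadius (hZ : Z.IsSmoothAffineCurve) (hK : IsCompact K)
    (hKZ : K ⊆ Z.points) {r : ℝ} (hr : 0 < r) :
    ∃ σ > 0, ∀ k ∈ K, ∃ c : SoloInformedChart Z,
      ball k σ ∩ Z.points ⊆ soloInformedCore c ∧ soloInformedCore c ⊆ ball k r := by
  let ι := {q : (Fin Z.n → ℂ) × ℝ × SoloInformedChart Z //
    ball q.1 q.2.1 ∩ Z.points ⊆ soloInformedCore q.2.2 ∧ q.2.2.Ω ⊆ ball q.1 (r / 2) ∧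
      q.2.1 ≤ r / 2}
  have hcov : K ⊆ ⋃ i : ι, ball i.1.1 i.1.2.1 := by
    intro k hk
    obtain ⟨c, hkc, hΩ⟩ := soloInformed_exists_chart_core_subset hZ (hKZ hk) isOpen_ball
      (mem_ball_self (half_pos hr))
    obtain ⟨ρ, hρ, hsub⟩ := soloInformed_exists_ball_subset_core c hkc
    refine mem_iUnion.2 ⟨⟨(k, min ρ (r / 2), c), fun z hz =>
      hsub ⟨ball_subset_ball (min_le_left _ _) hz.1, hz.2⟩, hΩ, min_le_right _ _⟩, ?_⟩
    exact mem_ball_self (lt_min hρ (half_pos hr))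
  obtain ⟨δ, hδ, hleb⟩ := lebesgue_number_lemma_of_metric hK (fun _ : ι => isOpen_ball) hcov
  refine ⟨δ, hδ, fun k hk => ?_⟩
  obtain ⟨⟨⟨g, ρ, c⟩, hsub, hΩ, hρr⟩, hi⟩ := hleb k hk
  have hkg : dist k g < r / 2 := lt_of_lt_of_le (mem_ball.1 (hi (mem_ball_self hδ))) hρr
  refine ⟨c, fun z hz => hsub ⟨hi hz.1, hz.2⟩, fun z hz => ?_⟩
  have hz' : dist z g < r / 2 := mem_ball.1 (hΩ hz.2.1)
  rw [mem_ball]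
  calc dist z k ≤ dist z g + dist g k := dist_triangle _ _ _
    _ < r / 2 + r / 2 := add_lt_add hz' (by rwa [dist_comm] at hkg)
    _ = r := by ring

end Summit.KontsevichZagierPeriods.KontsevichZagierPeriods.Theorems
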